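import Mathlib
import Summits.ValiantsHypothesis.ValiantsHypothesis.Theorems.GrenetZeonTwoDimCoefficientsDefs

/-!
# Crux `GrenetZeon.TwoDimCoefficients` (stmt-ValiantsHypothesis-8062), stub `stub_dualUnipotent`:
# the wild core, part 5 — the INDEX lever is dead too: an irreducible nilpotent plane containing a regular nilpotent

Part 4 (✓ `…WildCoreRungClosure`, this seat) closed the DIMENSION lever on the irreducible Jordan–Hölder block of a
unipotent-dual representation of `per_n`.  The other per-free invariant a recursion on that block could hope to use
is the NIL-INDEX: the pencil has index `≥ n` (`N^{n−1} ≢ 0`), the indices of the diagonal blocks add up, so a law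
«an IRREDUCIBLE nilpotent subspace of `M_s(ℂ)` has index `≤ s/2`» (or any `≤ s − g(s)` with `g → ∞`) would convert
width into block count.  No such law exists: irreducibility does not bound the index below the size.  The witness is
the textbook plane of Radjavi–Rosenthal (*Simultaneous Triangularization*, Example 1.7.11),

  `V = { [[0, a, 0], [b, 0, −a], [0, b, 0]] : a, b ∈ ℂ } ⊂ M_3(ℂ)`,

every member of which cubes to zero (`(aE + bF)² = [[ab, 0, −a²], [0, 0, 0], [b², 0, −ab]]`, then `·(aE + bF) = 0`), which has NO
non-trivial proper invariant subspace, and which contains the REGULAR nilpotent `E = [[0,1,0],[0,0,−1],[0,0,0]]`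
(`E² ≠ 0`, index `3 =` size).  (At every size `s ≥ 4` the tree's orbit cone `S₃(s)` — ✓
`HeavyTopIrreducibleSThreeFamily` — even contains REGULAR nilpotents: for a generic member `X = N + αc + βv` the chain
`e_T → e_L → e_k → ⋯ → e_0 → αe_T + βe_B` has `s − 1` steps, so `X^{s−1} e_T = βγ·(αe_T + βe_B) ≠ 0` with
`γ = N_{01}N_{12}⋯N_{k,k+1}`, while `X² e_0 = αβe_L − βαe_L = 0` keeps `X^s = 0`; that paper computation is recorded in
the census memo `census-8062-g6.md` on stmt-8062 — CORRECTION of the first landing's «index s − 1» — and is not typed here.)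

* `exists_irreducible_nilpotent_with_regular` — the statement above, in the binder shape of
  ✓ `sq_bound_of_irreducible_dim_bound` / ✓ `exists_large_irreducible_block`;
* `not_irreducible_index_lt_size` (§2, appended) — the index-law SHAPE «every member `A` of an irreducible nilpotent
  subspace of `M_s(ℂ)` has `A^{s−1} = 0`» is false (at `s = 3`).

HONEST FRAMING: a 3 × 3 linear-algebra witness closing a tempting per-free lever; landed
`--supports stmt-ValiantsHypothesis-8062 --as helper`; nothing about the permanent is proved — `stub_dualUnipotent`,
the crux, 24318 and `VP ≠ VNP` are NOT proved.

References: H. Radjavi, P. Rosenthal, *Simultaneous Triangularization* (Springer Universitext, 2000), Example 1.7.11;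
B. Mathes, M. Omladič, H. Radjavi, Linear Algebra Appl. 149 (1991) 215–225.
-/

-- single-conjunct layout `Summits/ValiantsHypothesis/ValiantsHypothesis`: the duplicated namespace
-- component is mandated by the tree.
set_option linter.dupNamespace false

noncomputable section

namespace Summit.ValiantsHypothesis.ValiantsHypothesis.Cruxes.TwoDimCoefficients.DimTwoCases

open Matrix

/-- **Radjavi–Rosenthal's plane.**  There is a linear subspace `V ⊆ M_3(ℂ)` of nilpotent matrices without a
non-trivial proper invariant subspace which contains a matrix `A` with `A² ≠ 0` (a regular nilpotent: index = size).
So «irreducible ⟹ index < size» fails already at `s = 3`; no index law can feed the block recursion of the wild core.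
[cite: RadjaviRosenthal2000, Example 1.7.11] -/
theorem exists_irreducible_nilpotent_with_regular :
    ∃ V : Submodule ℂ (Matrix (Fin 3) (Fin 3) ℂ), (∀ A ∈ V, IsNilpotent A) ∧
      (∀ U : Submodule ℂ (Fin 3 → ℂ), (∀ A ∈ V, ∀ x ∈ U, A *ᵥ x ∈ U) → U = ⊥ ∨ U = ⊤) ∧
      ∃ A ∈ V, A ^ 2 ≠ 0 := by
  -- the two generators
  set E : Matrix (Fin 3) (Fin 3) ℂ := !![0, 1, 0; 0, 0, -1; 0, 0, 0] with hE
  set F : Matrix (Fin 3) (Fin 3) ℂ := !![0, 0, 0; 1, 0, 0; 0, 1, 0] with hF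
  have hEV : E ∈ Submodule.span ℂ ({E, F} : Set (Matrix (Fin 3) (Fin 3) ℂ)) :=
    Submodule.subset_span (by simp)
  have hFV : F ∈ Submodule.span ℂ ({E, F} : Set (Matrix (Fin 3) (Fin 3) ℂ)) :=
    Submodule.subset_span (by simp)
  -- the general member
  have hmem : ∀ A ∈ Submodule.span ℂ ({E, F} : Set (Matrix (Fin 3) (Fin 3) ℂ)),
      ∃ a b : ℂ, A = !![0, a, 0; b, 0, -a; 0, b, 0] := by
    intro A hA
    obtain ⟨a, b, h⟩ := Submodule.mem_span_pair.mp hA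
    refine ⟨a, b, ?_⟩
    rw [← h, hE, hF]
    ext i j
    fin_cases i <;> fin_cases j <;> simp
  -- action on vectors
  have hEx : ∀ x : Fin 3 → ℂ, E *ᵥ x = ![x 1, -x 2, 0] := by
    intro x
    ext i
    fin_cases i <;> simp [hE, Matrix.mulVec, dotProduct, Fin.sum_univ_three]
  have hFx : ∀ x : Fin 3 → ℂ, F *ᵥ x = ![0, x 0, x 1] := by
    intro x
    ext i
    fin_cases i <;> simp [hF, Matrix.mulVec, dotProduct, Fin.sum_univ_three]
  refine ⟨Submodule.span ℂ {E, F}, ?_, ?_, ⟨E, hEV, ?_⟩⟩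
  · -- nilpotent: the cube of the general member vanishes
    intro A hA
    obtain ⟨a, b, rfl⟩ := hmem A hA
    refine ⟨3, ?_⟩
    have h2 : !![0, a, 0; b, 0, -a; 0, b, 0] * !![0, a, 0; b, 0, -a; 0, b, 0]
        = !![a * b, 0, -(a * a); 0, 0, 0; b * b, 0, -(a * b)] := by
      ext i j
      fin_cases i <;> fin_cases j <;> simp [Matrix.mul_apply, Fin.sum_univ_three] <;> ring
    rw [pow_succ, pow_two, h2]
    ext i j
    fin_cases i <;> fin_cases j <;> simp [Matrix.mul_apply, Fin.sum_univ_three] <;> ring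
  · -- irreducible
    intro U hU
    by_cases hbot : U = ⊥
    · exact Or.inl hbot
    right
    obtain ⟨x, hxU, hx0⟩ := (Submodule.ne_bot_iff U).mp hbot
    -- step 1: `e₂ ∈ U`
    have he2 : (![0, 0, 1] : Fin 3 → ℂ) ∈ U := by
      have hFx1 : F *ᵥ x ∈ U := hU F hFV x hxU
      have hFx2 : F *ᵥ (F *ᵥ x) ∈ U := hU F hFV _ hFx1
      rw [hFx] at hFx1
      rw [hFx, hFx] at hFx2
      simp only [Matrix.cons_val_zero, Matrix.cons_val_one] at hFx2
      by_cases h0 : x 0 = 0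
      · by_cases h1 : x 1 = 0
        · -- `x = x₂ • e₂`
          have h2 : x 2 ≠ 0 := by
            intro h2
            apply hx0
            ext i
            fin_cases i <;> simp [h0, h1, h2]
          have hx : x = x 2 • (![0, 0, 1] : Fin 3 → ℂ) := by
            ext i
            fin_cases i <;> simp [h0, h1]
          have h3 : (x 2)⁻¹ • ((x 2) • (![0, 0, 1] : Fin 3 → ℂ)) ∈ U := by
            rw [← hx]
            exact U.smul_mem _ hxU
          rwa [smul_smul, inv_mul_cancel₀ h2, one_smul] at h3
        · -- `F x = (0, 0, x₁)`
          have hv : (![0, x 0, x 1] : Fin 3 → ℂ) = x 1 • (![0, 0, 1] : Fin 3 → ℂ) := by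
            ext i
            fin_cases i <;> simp [h0]
          have := U.smul_mem (x 1)⁻¹ hFx1
          rw [hv, smul_smul, inv_mul_cancel₀ h1, one_smul] at this
          exact this
      · -- `F (F x) = (0, 0, x₀)`
        have hv : (![0, 0, x 0] : Fin 3 → ℂ) = x 0 • (![0, 0, 1] : Fin 3 → ℂ) := by
          ext i
          fin_cases i <;> simp
        have := U.smul_mem (x 0)⁻¹ hFx2
        rw [hv, smul_smul, inv_mul_cancel₀ h0, one_smul] at this
        exact this
    -- step 2: `e₁ ∈ U` (`E e₂ = −e₁`) and `e₀ ∈ U` (`E e₁ = e₀`)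
    have he1 : (![0, 1, 0] : Fin 3 → ℂ) ∈ U := by
      have h := hU E hEV _ he2
      rw [hEx] at h
      have hv : (![(![0, 0, 1] : Fin 3 → ℂ) 1, -(![0, 0, 1] : Fin 3 → ℂ) 2, 0] : Fin 3 → ℂ)
          = (-1 : ℂ) • (![0, 1, 0] : Fin 3 → ℂ) := by
        ext i
        fin_cases i <;> simp
      rw [hv] at h
      have := U.smul_mem (-1 : ℂ) h
      rw [smul_smul] at this
      norm_num at this
      exact this
    have he0 : (![1, 0, 0] : Fin 3 → ℂ) ∈ U := by
      have h := hU E hEV _ he1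
      rw [hEx] at h
      have hv : (![(![0, 1, 0] : Fin 3 → ℂ) 1, -(![0, 1, 0] : Fin 3 → ℂ) 2, 0] : Fin 3 → ℂ)
          = (![1, 0, 0] : Fin 3 → ℂ) := by
        ext i
        fin_cases i <;> simp
      rw [hv] at h
      exact h
    -- step 3: `U = ⊤`
    rw [eq_top_iff]
    intro y _
    have hy : y = y 0 • (![1, 0, 0] : Fin 3 → ℂ) + y 1 • (![0, 1, 0] : Fin 3 → ℂ)
        + y 2 • (![0, 0, 1] : Fin 3 → ℂ) := by
      ext i
      fin_cases i <;> simp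
    rw [hy]
    exact U.add_mem (U.add_mem (U.smul_mem _ he0) (U.smul_mem _ he1)) (U.smul_mem _ he2)
  · -- `E² ≠ 0` (entry `(0,2)` is `−1`)
    intro h
    have h02 := congrFun (congrFun h 0) 2
    rw [pow_two, hE] at h02
    simp [Matrix.mul_apply, Fin.sum_univ_three] at h02

/-! ### §2 The index-law shape is false -/

/-- **No index law.**  It is NOT the case that every member `A` of every irreducible nilpotent linear subspace of
`M_s(ℂ)` satisfies `A^{s−1} = 0` (i.e. has index below the size): Radjavi–Rosenthal's plane at `s = 3` contains a
regular nilpotent.  (So the Jordan–Hölder block recursion of the wild core cannot trade the pencil's index `≥ n` for a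
block count through irreducibility.) [cite: RadjaviRosenthal2000, Example 1.7.11] -/
theorem not_irreducible_index_lt_size :
    ¬ ∀ (s : ℕ) (V : Submodule ℂ (Matrix (Fin s) (Fin s) ℂ)), (∀ A ∈ V, IsNilpotent A) →
      (∀ U : Submodule ℂ (Fin s → ℂ), (∀ A ∈ V, ∀ x ∈ U, A *ᵥ x ∈ U) → U = ⊥ ∨ U = ⊤) →
      ∀ A ∈ V, A ^ (s - 1) = 0 := by
  intro h
  obtain ⟨V, hnil, hirr, A, hA, hA2⟩ := exists_irreducible_nilpotent_with_regular
  exact hA2 (h 3 V hnil hirr A hA)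

end Summit.ValiantsHypothesis.ValiantsHypothesis.Cruxes.TwoDimCoefficients.DimTwoCases

end
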